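import Summits.QuantumFields.BalabanUV.Beta.WardLocusSecondOrderLaw

/-!
# `BalabanUV.Beta.KernelWardSwap` — binder row D1, (L4) W-side: THE SWAPPED BI-VERTEX PIECE of the second-order Ward socket for the
# SYMMETRISED carrier `W2SymOfK` (the (μ,y)-divergence lands on the SECOND slot of the bi-table)
# (β sub-cell, D1 formalisation swarm, unit `b2b-balaban-beta-d1-formalise-leaf-10`, gen 2; CLAIM «D1-hW-L4-SWAP», part 1)

NOT IN PRINT; OUR BOOKKEEPING.  HONEST FRAMING (cell contract, verbatim): «discharging `BetaPertH` makes Bałaban's UV stability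
UNCONDITIONAL — a real constructive-QFT result; it is NOT the continuum limit and NOT the Clay problem.»  HONEST DEPENDENCY (verbatim):
«continuum YM on T⁴ ⇐ BetaPertH ∧ nine spine estimates (0/9 proved); BetaPertH ⇐ (D1) ∧ (D4) ∧ CAP+tail; G-an2-4 gates asym, D1 and
NE2/3/4.»  [folklore] kernel algebra; the table law is a DISPLAYED HYPOTHESIS; instantiates NO binder of the β-function wall; no `[cite:]`, no
`def`, no `def … : Prop`; NOT D1, NOT `BetaPertH`, NOT continuum, NOT Clay.

## What

an2's W-literal is the swap-symmetrised carrier `W2SymOfK K N S M S₂ M₂ μ y ν y′ = ½ (W2OfK … μ y ν y′ + W2OfK … ν y′ μ y)`; an1's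
`KernelWardMixedLaw`/`KernelWardResponse`/`KernelWardResidual` treat the DIRECT ordering.  In the SWAPPED ordering the bi-vertex term is
`vertex2OfK K N S₂ ν y′ μ y = vertexOfK K N (κ u ↦ vertexOfK K N (S₂ κ u) μ y) ν y′` — the bond `(μ, y)` now sits on the SECOND slot of `S₂`.
* §1 `vertexOfK_vertexOfK_comm` (Fubini for two chain-rule superpositions of a bounded bi-table) and
  **`vertex2OfK_swap_eq_transpose`**: `vertex2OfK K N S₂ ν y′ μ y = vertex2OfK K N S₂ᵀ μ y ν y′` with the TRANSPOSED bi-table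
  `S₂ᵀ κ′ u′ κ u := S₂ κ u κ′ u′`.
* §2 **`divW_vertex2OfK_swap_of_tableLaw`**: under (hH) and the SECOND-SLOT table law
  (T2-S₂)″ `cH • Σ_{v∈box} divV (S₂ κ u) (N•y + v) = S κ u ∘ X y − X y ∘ S κ u + R″ y κ u`:
  `divW (μ y ν y′ ↦ vertex2OfK K N S₂ ν y′ μ y) y ν y′ = V′∘X y − X y∘V′ + vertexOfK K N (R″ y) ν y′` (`V′ = vertexOfK K N S ν y′`) — the SAME
  `conjW₁` half as the direct piece P1 (leaf-10 `divW_vertex2OfK_of_tableLaw`, applied to `S₂ᵀ`), so the symmetrised carrier AVERAGES the two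
  remainders `R`, `R″`; wall instance over `G_j`.
The swapped mixed terms are the direct ones with roles exchanged (P2, P3 — in tree); the swapped RESPONSE piece is part 2 (`KernelWardSwapResponse`).
-/

noncomputable section

open Finset
open scoped BigOperators
open Literature.MathematicalPhysics.QuantumFieldTheory
open Literature.MathematicalPhysics.QuantumFieldTheory.Balaban1983to89
open Literature.MathematicalPhysics.QuantumFieldTheory.Balaban1983to89.Beta
open B6BondElimination (unitVec)
open ExpKernelCalculus (MKer Decays comp)
open KernelWard (divV divW ProdBound tsum_comm_of_prodBound)
open AffineAveraging (box toSite)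
open OneStepResolventKernel (Fib wsum LocStencil)
open OneStepKernelFamily (KInvStep colH vertexOfK)
open SecondOrderResponse (vertex2OfK)
open Summit.QuantumFields.BalabanUV.Beta.TameKernelCalculus
open Summit.QuantumFields.BalabanUV.Beta.ChartConjugation (conjV)
open Summit.QuantumFields.BalabanUV.Beta.ChartConjugationReflection (summable_abs_colH)
open Summit.QuantumFields.BalabanUV.Beta.KernelWardRelative (gaugeWt)
open Summit.QuantumFields.BalabanUV.Beta.AxialDressingRooted (coDressKBmAt decays_coDressKBmAt_KInvStep)
open Summit.QuantumFields.BalabanUV.Beta.BorderedHessian (stepScale)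
open Summit.QuantumFields.BalabanUV.Beta.KernelWardHColumnWall (colH_ward_KInvStep_all)
open Summit.QuantumFields.BalabanUV.Beta.WardLocusSecondOrderLaw (divW_vertex2OfK_of_tableLaw)

namespace Summit.QuantumFields.BalabanUV.Beta.KernelWardSwap

variable {d : ℕ} {N : ℕ}

/-! ## §1 Fubini for two chain-rule superpositions; the swapped bi-vertex is the direct bi-vertex of the transposed table -/

/-- [folklore] **TWO CHAIN-RULE SUPERPOSITIONS COMMUTE** over a bounded bi-table:
`vertexOfK K N (κ u ↦ vertexOfK K N (S₂ κ u) μ y) ν y′ = vertexOfK K N (κ′ u′ ↦ vertexOfK K N (κ u ↦ S₂ κ u κ′ u′) ν y′) μ y`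
(absolutely summable `colH` weights, bounded entries: product majorant, `KernelWard.tsum_comm_of_prodBound`). -/
theorem vertexOfK_vertexOfK_comm [NeZero N] {K : MKer (d + 1) (Fib d)} (hK : ∃ δ C : ℝ, 0 < δ ∧ 0 ≤ C ∧ Decays K C δ)
    {S₂ : Fin (d + 1) → (Fin (d + 1) → ℤ) → Fin (d + 1) → (Fin (d + 1) → ℤ) → MKer (d + 1) (Fib d)} {B₂ : ℝ}
    (hB₂ : ∀ κ u κ' u' x z a b, |S₂ κ u κ' u' x z a b| ≤ B₂) (μ : Fin (d + 1)) (y : Fin (d + 1) → ℤ) (ν : Fin (d + 1))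
    (y' : Fin (d + 1) → ℤ) :
    vertexOfK K N (fun κ u => vertexOfK K N (S₂ κ u) μ y) ν y' =
      vertexOfK K N (fun κ' u' => vertexOfK K N (fun κ u => S₂ κ u κ' u') ν y') μ y := by
  funext x z a b
  simp only [vertexOfK, OneStepResolventKernel.wsum]
  -- the double family per (κ, κ')
  set G : Fin (d + 1) → Fin (d + 1) → (Fin (d + 1) → ℤ) → (Fin (d + 1) → ℤ) → ℝ :=
    fun κ κ' u u' => colH K N ν y' κ u * (colH K N μ y κ' u' * S₂ κ u κ' u' x z a b) with hG
  have hPB : ∀ κ κ', ProdBound (G κ κ') := fun κ κ' =>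
    ⟨fun u => |colH K N ν y' κ u| * |B₂|, fun u' => |colH K N μ y κ' u'|, (summable_abs_colH (N := N) hK ν y' κ).mul_right _,
      summable_abs_colH (N := N) hK μ y κ', fun u => by positivity, fun u' => abs_nonneg _, fun u u' => by
        rw [hG, abs_mul, abs_mul]
        calc |colH K N ν y' κ u| * (|colH K N μ y κ' u'| * |S₂ κ u κ' u' x z a b|)
            ≤ |colH K N ν y' κ u| * (|colH K N μ y κ' u'| * |B₂|) :=
              mul_le_mul_of_nonneg_left (mul_le_mul_of_nonneg_left ((hB₂ κ u κ' u' x z a b).trans (le_abs_self _)) (abs_nonneg _))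
                (abs_nonneg _)
          _ = _ := by ring⟩
  have hS1 : ∀ κ κ' u, Summable fun u' => G κ κ' u u' := fun κ κ' u => ((hPB κ κ').summable).2.1 u
  have hS2 : ∀ κ κ' u', Summable fun u => G κ κ' u u' := fun κ κ' u' => ((hPB κ κ').summable).2.2 u'
  have hS3 : ∀ κ κ', Summable fun u => ∑' u', G κ κ' u u' := fun κ κ' => ((hPB κ κ').summable).1.prod
  have hS4 : ∀ κ κ', Summable fun u' => ∑' u, G κ κ' u u' := fun κ κ' => ((hPB κ κ').summable).1.prod_symm.prod
  -- left: Σ_κ Σ'_u colH * (Σ_κ' Σ'_u' colH' * S₂) = Σ_κ Σ_κ' Σ'_u Σ'_u' G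
  have lhs : ∑ κ, ∑' u, colH K N ν y' κ u * ∑ κ', ∑' u', colH K N μ y κ' u' * S₂ κ u κ' u' x z a b
      = ∑ κ, ∑ κ', ∑' u, ∑' u', G κ κ' u u' := by
    refine Finset.sum_congr rfl fun κ _ => ?_
    have e : ∀ u, colH K N ν y' κ u * ∑ κ', ∑' u', colH K N μ y κ' u' * S₂ κ u κ' u' x z a b = ∑ κ', ∑' u', G κ κ' u u' := by
      intro u
      rw [Finset.mul_sum]
      refine Finset.sum_congr rfl fun κ' _ => ?_
      rw [← tsum_mul_left]
    simp only [e]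
    exact Summable.tsum_finsetSum (fun κ' _ => hS3 κ κ')
  have rhs : ∑ κ', ∑' u', colH K N μ y κ' u' * ∑ κ, ∑' u, colH K N ν y' κ u * S₂ κ u κ' u' x z a b
      = ∑ κ', ∑ κ, ∑' u', ∑' u, G κ κ' u u' := by
    refine Finset.sum_congr rfl fun κ' _ => ?_
    have e : ∀ u', colH K N μ y κ' u' * ∑ κ, ∑' u, colH K N ν y' κ u * S₂ κ u κ' u' x z a b = ∑ κ, ∑' u, G κ κ' u u' := by
      intro u'
      rw [Finset.mul_sum]
      refine Finset.sum_congr rfl fun κ _ => ?_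
      rw [← tsum_mul_left]
      exact tsum_congr fun u => by rw [hG]; ring
    simp only [e]
    exact Summable.tsum_finsetSum (fun κ _ => hS4 κ κ')
  rw [lhs, rhs, Finset.sum_comm]
  refine Finset.sum_congr rfl fun κ' _ => Finset.sum_congr rfl fun κ _ => ?_
  exact tsum_comm_of_prodBound (hPB κ κ')

/-- [folklore] **THE SWAPPED BI-VERTEX IS THE DIRECT BI-VERTEX OF THE TRANSPOSED TABLE**:
`vertex2OfK K N S₂ ν y′ μ y = vertex2OfK K N (κ′ u′ κ u ↦ S₂ κ u κ′ u′) μ y ν y′`. -/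
theorem vertex2OfK_swap_eq_transpose [NeZero N] {K : MKer (d + 1) (Fib d)} (hK : ∃ δ C : ℝ, 0 < δ ∧ 0 ≤ C ∧ Decays K C δ)
    {S₂ : Fin (d + 1) → (Fin (d + 1) → ℤ) → Fin (d + 1) → (Fin (d + 1) → ℤ) → MKer (d + 1) (Fib d)} {B₂ : ℝ}
    (hB₂ : ∀ κ u κ' u' x z a b, |S₂ κ u κ' u' x z a b| ≤ B₂) (μ : Fin (d + 1)) (y : Fin (d + 1) → ℤ) (ν : Fin (d + 1))
    (y' : Fin (d + 1) → ℤ) :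
    vertex2OfK K N S₂ ν y' μ y = vertex2OfK K N (fun κ' u' κ u => S₂ κ u κ' u') μ y ν y' := by
  unfold SecondOrderResponse.vertex2OfK
  exact vertexOfK_vertexOfK_comm hK hB₂ μ y ν y'

/-! ## §2 The swapped bi-vertex piece under the second-slot table law -/

section TableLaw

variable [NeZero N]

/-- [folklore] **THE SWAPPED BI-VERTEX PIECE OF THE SECOND-ORDER WARD SOCKET.**  For a decaying `K` with (hH), a LOCAL first-order table `S`,
a bounded bi-table `S₂` obeying the SECOND-SLOT table-level Ward law (T2-S₂)″ against spread generators `X y` with a bounded remainder `R″`: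
`divW (μ y ν y′ ↦ vertex2OfK K N S₂ ν y′ μ y) y ν y′ = V′∘X y − X y∘V′ + vertexOfK K N (R″ y) ν y′`, `V′ = vertexOfK K N S ν y′` — literally
the `conjW₁ 0 V′ (X y) 0` half of the hW socket, as for the direct piece. -/
theorem divW_vertex2OfK_swap_of_tableLaw {K : MKer (d + 1) (Fib d)} (hK : ∃ δ C : ℝ, 0 < δ ∧ 0 ≤ C ∧ Decays K C δ)
    {S : Fin (d + 1) → (Fin (d + 1) → ℤ) → MKer (d + 1) (Fib d)} {Cs δs : ℝ} (hS : LocStencil S Cs δs) (hδs : 0 < δs)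
    {S₂ : Fin (d + 1) → (Fin (d + 1) → ℤ) → Fin (d + 1) → (Fin (d + 1) → ℤ) → MKer (d + 1) (Fib d)} {B₂ : ℝ}
    (hB₂ : ∀ κ u κ' u' x z a b, |S₂ κ u κ' u' x z a b| ≤ B₂) (cH : ℝ)
    (hH : ∀ (y : Fin (d + 1) → ℤ) (κ' : Fin (d + 1)) (u : Fin (d + 1) → ℤ),
      ∑ μ, (colH K N μ (y - unitVec μ) κ' u - colH K N μ y κ' u) = cH * gaugeWt N y κ' u)
    {X : (Fin (d + 1) → ℤ) → MKer (d + 1) (Fib d)} (hX : ∀ y, Spr (X y))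
    {R : (Fin (d + 1) → ℤ) → Fin (d + 1) → (Fin (d + 1) → ℤ) → MKer (d + 1) (Fib d)} {BR : ℝ}
    (hR : ∀ y κ u x z a b, |R y κ u x z a b| ≤ BR)
    (hS₂ : ∀ (y : Fin (d + 1) → ℤ) (κ : Fin (d + 1)) (u : Fin (d + 1) → ℤ),
      cH • ∑ v ∈ box (d + 1) N, divV (S₂ κ u) ((N : ℤ) • y + toSite v) = comp (S κ u) (X y) - comp (X y) (S κ u) + R y κ u)
    (y : Fin (d + 1) → ℤ) (ν : Fin (d + 1)) (y' : Fin (d + 1) → ℤ) :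
    divW (fun μ y ν y' => vertex2OfK K N S₂ ν y' μ y) y ν y' =
      comp (vertexOfK K N S ν y') (X y) - comp (X y) (vertexOfK K N S ν y') + vertexOfK K N (R y) ν y' := by
  -- the swapped bi-vertex is the direct bi-vertex of the transposed table
  have eW : divW (fun μ y ν y' => vertex2OfK K N S₂ ν y' μ y) y ν y' = divW (vertex2OfK K N (fun κ' u' κ u => S₂ κ u κ' u')) y ν y' := by
    simp only [KernelWard.divW, vertex2OfK_swap_eq_transpose hK hB₂]
  rw [eW]
  -- the second-slot law of `S₂` is the first-slot law of `S₂ᵀ`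
  exact divW_vertex2OfK_of_tableLaw hK hS hδs (fun κ u κ' u' x z a b => hB₂ κ' u' κ u x z a b) cH hH hX hR
    (fun y κ' u' => by simpa using hS₂ y κ' u') y ν y'

end TableLaw

/-! ## §3 The wall instance: `G_j = coDressKBmAt (toSite r) Lc (KInvStep Lc j)`, every level, every in-block root -/

section Wall

variable {Lc : ℕ} [NeZero Lc] {r : Fin (d + 1) → ℕ}

/-- [folklore] **THE SWAPPED BI-VERTEX PIECE OVER THE WALL'S STEP PROPAGATOR**, every `j`, every in-block root, (hH) discharged by leaf-07's
`colH_ward_KInvStep_all` (`cH = (stepScale d Lc j · Lc^{d+1})⁻¹`); the second-slot law (T2-S₂)″ stays a displayed hypothesis. -/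
theorem divW_vertex2OfK_swap_coDressKBmAt_KInvStep_of_tableLaw (hr : r ∈ box (d + 1) Lc) (j : ℕ)
    {S : Fin (d + 1) → (Fin (d + 1) → ℤ) → MKer (d + 1) (Fib d)} {Cs δs : ℝ} (hS : LocStencil S Cs δs) (hδs : 0 < δs)
    {S₂ : Fin (d + 1) → (Fin (d + 1) → ℤ) → Fin (d + 1) → (Fin (d + 1) → ℤ) → MKer (d + 1) (Fib d)} {B₂ : ℝ}
    (hB₂ : ∀ κ u κ' u' x z a b, |S₂ κ u κ' u' x z a b| ≤ B₂)
    {X : (Fin (d + 1) → ℤ) → MKer (d + 1) (Fib d)} (hX : ∀ y, Spr (X y))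
    {R : (Fin (d + 1) → ℤ) → Fin (d + 1) → (Fin (d + 1) → ℤ) → MKer (d + 1) (Fib d)} {BR : ℝ}
    (hR : ∀ y κ u x z a b, |R y κ u x z a b| ≤ BR)
    (hS₂ : ∀ (y : Fin (d + 1) → ℤ) (κ : Fin (d + 1)) (u : Fin (d + 1) → ℤ),
      (stepScale d Lc j * (Lc : ℝ) ^ (d + 1))⁻¹ • ∑ v ∈ box (d + 1) Lc, divV (S₂ κ u) ((Lc : ℤ) • y + toSite v) =
        comp (S κ u) (X y) - comp (X y) (S κ u) + R y κ u)
    (y : Fin (d + 1) → ℤ) (ν : Fin (d + 1)) (y' : Fin (d + 1) → ℤ) :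
    divW (fun μ y ν y' => vertex2OfK (coDressKBmAt (toSite r) Lc (KInvStep (d := d) Lc j)) Lc S₂ ν y' μ y) y ν y' =
      comp (vertexOfK (coDressKBmAt (toSite r) Lc (KInvStep (d := d) Lc j)) Lc S ν y') (X y)
        - comp (X y) (vertexOfK (coDressKBmAt (toSite r) Lc (KInvStep (d := d) Lc j)) Lc S ν y')
        + vertexOfK (coDressKBmAt (toSite r) Lc (KInvStep (d := d) Lc j)) Lc (R y) ν y' :=
  divW_vertex2OfK_swap_of_tableLaw (decays_coDressKBmAt_KInvStep hr j) hS hδs hB₂ _ (colH_ward_KInvStep_all hr j) hX hR hS₂ y ν y'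

end Wall

end Summit.QuantumFields.BalabanUV.Beta.KernelWardSwap

end
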